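import Mathlib
import Literature.Computability.AlgebraicComplexity.BCGPUInfiniteGroups
import Summits.MatrixMultiplication.MatrixMultiplication.Theorems.SoloInformedSeparationCriterion

/-!
# The twist-rank bound: a fixed degeneracy locus hosts only boundedly many `Y`

Setting of Blasiak–Cohn–Grochow–Pratt–Umans (arXiv:2410.14905, Def. 2.1): a TPP triple
`X, Y, Z` in a group `G` with a separating family.  In the sibling file
`SoloInformedSeparationCriterion` the separating functions of a *cell-function design* vanish at
the twisted points because every twist `w = y⁻¹ y'` (`y ≠ y'` in `Y`) lies in a fixed locus
`𝒯 = {Φ = 0}` with `1 ∉ 𝒯` (for the `GL₂` flip design: `𝒯 = {w₁₁ = 0}`, the closure of the Bruhat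
cell `B⁻ σ B⁺`).

**New here (soloist).**
* `card_le_of_twist_rank`: if `Φ(1) ≠ 0`, `Φ(y⁻¹ y') = 0` for all `y ≠ y'` in `Y`, and the kernel
  `(y, y') ↦ Φ(y⁻¹ y')` has rank `≤ m` (`= ∑_{k<m} u_k(y) v_k(y')`), then `|Y| ≤ m` — the matrix
  `(Φ(y⁻¹y'))` is `Φ(1)·Id` of rank `|Y|`.
* `glN_card_le_of_diag_twists`: in `GL_n(ℂ)`, if all twists have vanishing diagonal entry
  `(y⁻¹y')_{ii} = 0`, then `|Y| ≤ n` (`(y⁻¹y')_{ii} = ∑_j (y⁻¹)_{ij} y'_{ji}` has rank `n`).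
* `glTwo_flipLocus_volume_le`: consequently every `GL₂` design whose twists lie in the flip locus
  `{w₁₁ = 0}` — in particular every flip / Bruhat-cell design of the sibling file, for ANY finite
  `X ⊆ B⁻`, `Z⁻¹ ⊆ U⁺` — has `|Y| ≤ 2` and volume `|X||Y||Z| ≤ 2 · dim V`: these designs beat the
  trivial level `dim V_s = C(s+4,4)` by at most the factor `2`, never in the exponent
  (`3a = 4`, `ω ≤ 6` through BCGPU Cor. 2.8).  Reading for the Lie-group door: super-density
  (`volume ≥ (dim V)^{1+ε}`, needed with `ε → 1/2` for `ω = 2`, Rem. 2.3) cannot come from twists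
  confined to a fixed hypersurface `{Φ = 0}` of bounded twist-rank; the degeneracy locus of the
  twists must grow with the degree `s`.

References: [BlasiakCohnGrochowPrattUmans2024] arXiv:2410.14905, Def. 2.1, Thm. 2.2, Rem. 2.3,
Cor. 2.8; the rank argument is the one behind `s`-distance-set bounds (Delsarte–Goethals–Seidel
1977; Blokhuis 1984), here for a non-symmetric kernel on a group.
-/

noncomputable section

open scoped BigOperators
open Module

namespace Summit.MatrixMultiplication.MatrixMultiplication.Theorems

open Literature.Computability.AlgebraicComplexity

/-- **Twist-rank bound.** `Φ(1) ≠ 0`, `Φ(y⁻¹y') = 0` for `y ≠ y'` in `Y`, and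
`Φ(y⁻¹y') = ∑_{k<m} u_k(y) v_k(y')` on `Y × Y` imply `|Y| ≤ m`. [new; the diagonal-matrix rank
argument of s-distance-set theory] -/
theorem card_le_of_twist_rank {G : Type*} [Group G] (Y : Finset G) (Φ : G → ℂ) {m : ℕ}
    (u v : Fin m → G → ℂ)
    (hΦ : ∀ y ∈ Y, ∀ y' ∈ Y, Φ (y⁻¹ * y') = ∑ k, u k y * v k y')
    (h1 : Φ 1 ≠ 0) (hY : ∀ y ∈ Y, ∀ y' ∈ Y, y ≠ y' → Φ (y⁻¹ * y') = 0) :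
    Y.card ≤ m := by
  classical
  -- `T a = (k ↦ ∑_y a_y u_k(y))` is injective `ℂ^Y → ℂ^m`
  let T : (Y → ℂ) →ₗ[ℂ] (Fin m → ℂ) :=
    { toFun := fun a k => ∑ y : Y, a y * u k y
      map_add' := by
        intro a b; funext k
        simp only [Pi.add_apply, add_mul, Finset.sum_add_distrib]
      map_smul' := by
        intro c a; funext k
        simp only [Pi.smul_apply, smul_eq_mul, RingHom.id_apply, Finset.mul_sum, mul_assoc] }
  have hinj : Function.Injective T := by
    rw [← LinearMap.ker_eq_bot, LinearMap.ker_eq_bot']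
    intro a ha
    funext y₀
    have h := congrArg (fun b : Fin m → ℂ => ∑ k, b k * v k y₀) ha
    simp only [Pi.zero_apply, zero_mul, Finset.sum_const_zero] at h
    have h' : ∑ y : Y, a y * Φ ((y : G)⁻¹ * y₀) = 0 := by
      rw [← h]
      calc ∑ y : Y, a y * Φ ((y : G)⁻¹ * y₀)
          = ∑ y : Y, a y * ∑ k, u k y * v k y₀ := by
            refine Finset.sum_congr rfl fun y _ => ?_
            rw [hΦ y y.2 y₀ y₀.2]
        _ = ∑ k, (∑ y : Y, a y * u k y) * v k y₀ := by
            simp only [Finset.mul_sum, Finset.sum_mul, mul_assoc]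
            exact Finset.sum_comm
    rw [Finset.sum_eq_single y₀] at h'
    · have : a y₀ * Φ 1 = 0 := by simpa using h'
      simpa [h1] using this
    · intro y _ hy
      rw [hY y y.2 y₀ y₀.2 (fun e => hy (Subtype.ext e)), mul_zero]
    · intro h0; exact absurd (Finset.mem_univ y₀) h0
  have hle := LinearMap.finrank_le_finrank_of_injective hinj
  simpa [Module.finrank_fintype_fun_eq_card] using hle

/-- **Diagonal-entry twists in `GL_n`.** If every twist `y⁻¹y'` (`y ≠ y'` in `Y ⊆ GL_n(ℂ)`) has
vanishing `(i,i)` entry, then `|Y| ≤ n`:  `(y⁻¹y')_{ii} = ∑_j (y⁻¹)_{ij} y'_{ji}` is a kernel of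
rank `n` with value `1` on the diagonal. [new] -/
theorem glN_card_le_of_diag_twists {n : ℕ} (i : Fin n)
    (Y : Finset (Matrix.GeneralLinearGroup (Fin n) ℂ))
    (hY : ∀ y ∈ Y, ∀ y' ∈ Y, y ≠ y' →
      ((y⁻¹ * y' : Matrix.GeneralLinearGroup (Fin n) ℂ) : Matrix (Fin n) (Fin n) ℂ) i i = 0) :
    Y.card ≤ n := by
  have h := card_le_of_twist_rank Y
    (fun w => (w : Matrix (Fin n) (Fin n) ℂ) i i)
    (fun k y => ((y⁻¹ : Matrix.GeneralLinearGroup (Fin n) ℂ) : Matrix (Fin n) (Fin n) ℂ) i k)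
    (fun k y' => (y' : Matrix (Fin n) (Fin n) ℂ) k i) ?_ ?_ hY
  · exact h
  · intro y _ y' _
    simp only [Units.val_mul, Matrix.mul_apply]
  · simp

/-- **The flip locus hosts at most two `y`'s.** In `GL₂(ℂ)`, twists confined to `{w₁₁ = 0}`
(the closure of the Bruhat cell `B⁻σB⁺`, where the cell function `g₁₁` of the flip design
vanishes) force `|Y| ≤ 2`. [new] -/
theorem glTwo_card_le_two_of_flipLocus (Y : Finset GLTwo')
    (hY : ∀ y ∈ Y, ∀ y' ∈ Y, y ≠ y' →
      ((y⁻¹ * y' : GLTwo') : Matrix (Fin 2) (Fin 2) ℂ) 0 0 = 0) :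
    Y.card ≤ 2 :=
  glN_card_le_of_diag_twists (n := 2) 0 Y hY

/-- `Y = {1, σ}` attains it: the flip's twist `σ` has `σ₁₁ = 0`. [new] -/
theorem flip_pair_twists :
    ∀ y ∈ ({1, flip} : Finset GLTwo'), ∀ y' ∈ ({1, flip} : Finset GLTwo'), y ≠ y' →
      ((y⁻¹ * y' : GLTwo') : Matrix (Fin 2) (Fin 2) ℂ) 0 0 = 0 := by
  intro y hy y' hy' hne
  simp only [Finset.mem_insert, Finset.mem_singleton] at hy hy'
  have hw : y⁻¹ * y' = flip := by
    rcases hy with rfl | rfl <;> rcases hy' with rfl | rfl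
    · exact absurd rfl hne
    · simp
    · rw [flip_inv, mul_one]
    · exact absurd rfl hne
  rw [hw, coe_flip]
  simp [flipMat]

/-- **Volume bound on the flip locus.** Any TPP design in `GL₂(ℂ)` (embedding form) with a
separating family in a finite-dimensional `V` and all twists in `{w₁₁ = 0}` has
`|X| · |Y| · |Z| ≤ 2 · dim V`.  With `V = V_s` (`dim = C(s+4,4)`): the flip / Bruhat-cell designs
sit at the trivial exponent `3a = 4` of the `GL₂` door, at most a factor `2` above the trivial
level. [new; cf. BlasiakCohnGrochowPrattUmans2024, Thm. 2.2, Cor. 2.8] -/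
theorem glTwo_flipLocus_volume_le (V : Submodule ℂ (GLTwo' → ℂ)) [FiniteDimensional ℂ V]
    {X Y Z : Finset GLTwo'}
    (hTPP : ∀ x ∈ X, ∀ x' ∈ X, ∀ y ∈ Y, ∀ y' ∈ Y, ∀ z ∈ Z, ∀ z' ∈ Z,
      x * y⁻¹ * y' * z⁻¹ = x' * z'⁻¹ → x = x' ∧ y = y' ∧ z = z')
    (f : GLTwo' → GLTwo' → (GLTwo' → ℂ)) (hf : IsSeparatingFamily X Y Z f)
    (hfV : ∀ x ∈ X, ∀ z ∈ Z, f x z ∈ V)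
    (htwist : ∀ y ∈ Y, ∀ y' ∈ Y, y ≠ y' →
      ((y⁻¹ * y' : GLTwo') : Matrix (Fin 2) (Fin 2) ℂ) 0 0 = 0) :
    X.card * Y.card * Z.card ≤ 2 * finrank ℂ V := by
  rcases Y.eq_empty_or_nonempty with hY | hY
  · simp [hY]
  have hXZ : X.card * Z.card ≤ finrank ℂ V :=
    card_mul_le_finrank_of_separating V hY hTPP f hf hfV
  have hY2 : Y.card ≤ 2 := glTwo_card_le_two_of_flipLocus Y htwist
  calc X.card * Y.card * Z.card = Y.card * (X.card * Z.card) := by ring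
    _ ≤ 2 * finrank ℂ V := Nat.mul_le_mul hY2 hXZ

/-- The flip design itself (sibling file: `X ⊆ B⁻`, `Z⁻¹ ⊆ U⁺`, `Y = {1,σ}`, separators
`g₁₁ · g_{xz}` inside `V`): volume `= 2|X||Z| ≤ 2 · dim V`, for every finite-dimensional `V`
containing the separators. [new] -/
theorem glTwo_flip_design_volume_le (V : Submodule ℂ (GLTwo' → ℂ)) [FiniteDimensional ℂ V]
    {X Z : Finset GLTwo'}
    (hX : ∀ x ∈ X, (x : Matrix (Fin 2) (Fin 2) ℂ) 0 1 = 0)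
    (hZ : ∀ z ∈ Z, ((z⁻¹ : GLTwo') : Matrix (Fin 2) (Fin 2) ℂ) 1 0 = 0 ∧
      ((z⁻¹ : GLTwo') : Matrix (Fin 2) (Fin 2) ℂ) 0 0 = 1 ∧
      ((z⁻¹ : GLTwo') : Matrix (Fin 2) (Fin 2) ℂ) 1 1 = 1)
    (g : GLTwo' → GLTwo' → (GLTwo' → ℂ))
    (hg : ∀ x ∈ X, ∀ z ∈ Z, ∀ x' ∈ X, ∀ z' ∈ Z,
      g x z (x' * z'⁻¹) = if x = x' ∧ z = z' then 1 else 0)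
    (hgV : ∀ x ∈ X, ∀ z ∈ Z,
      (fun t : GLTwo' => (((x * z⁻¹ : GLTwo') : Matrix (Fin 2) (Fin 2) ℂ) 0 0)⁻¹ *
        (((t : GLTwo') : Matrix (Fin 2) (Fin 2) ℂ) 0 0 * g x z t)) ∈ V) :
    X.card * ({1, flip} : Finset GLTwo').card * Z.card ≤ 2 * finrank ℂ V :=
  glTwo_flipLocus_volume_le V (glTwo_flip_tpp hX hZ) _ (glTwo_flip_separating hX hZ g hg) hgV
    flip_pair_twists

end Summit.MatrixMultiplication.MatrixMultiplication.Theorems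

end
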